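import Literature.NumberTheory.PAdicHodge.BmaxPlusFrobeniusEigenTeichLog
import HarnessLib

/-!
# Structure of `(A_max)^{φ=p}`: every eigenvector is `p^{−M}(λ·t + p²·Λ^{log}([x₁] − 1))`

Topic `Literature/NumberTheory/PAdicHodge`; namespace `Literature.NumberTheory.PAdicHodge`. THEOREMS ONLY (no definition, no named
fact, no instance, no `sorry`). The `A_max`-internal form of Fontaine's `(B_cris⁺)^{φ=p} = ℚ_p·t ⊕? ℚ_p ⊗ log[1 + 𝔪♭]` (Colmez's `U`), on
Colmez's `A_max = B_max⁺(F)`: combining the IMAGE theorem `θ(X⁰_1) ⊇ p^Nℂ` (`BdRPlusLogTeich`), the `A_max`-lifts `Λ = p·log[x₁]` of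
Teichmüller logarithms (`BmaxPlusFrobeniusEigenTeichLog.exists_logSum_teichmuller`, edix-p4's `frobBmaxPlus_logSum_teichmuller_sub_one`) and
FONTAINE'S LEMMA (`BmaxPlusTDivisibilityAllPrimes`):

* ★★★ `exists_pow_mul_eq_logSum_add_zpToAinf_mul_tBmax` — **if `φ(x) = p·x` in `A_max` then `p^{N+3}·x = p²·Λ + ι(λ)·t`** for some `N`,
  `λ ∈ ℤ_p` and `Λ = Λ^{log}_1([x₁] − 1, z)` the `p`-adic logarithm sum of a Teichmüller lift `[x₁]`, `x₁ ∈ 1 + p♭𝒪♭` (itself a `φ = p`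
  eigenvector). So `(B_max⁺)^{φ=p} = ℚ_p·t + ℚ_p·{log[x] : x ∈ 1 + 𝔪♭}` — exactly, not only modulo `Fil^k`.

φ-road of line `kato_lever` (crux K★ `stmt-BirchSwinnertonDyer-22226`, memo `Cruxes/StarredOptimalManinUnitFiveSeven/Lines/kato-lever-K2-tdiv-g25.md` §4).
Infrastructure only: BSD / K★ are not proved by any of this.

## References
* [FontaineOuyang2022] J.-M. Fontaine, Y. Ouyang, *Theory of p-adic Galois representations*, §6.1 (the map `U → (B_cris⁺)^{φ=p}`, Thm. 6.26).
* [FontaineAsterisque223III] J.-M. Fontaine, *Le corps des périodes p-adiques*, Astérisque 223 (1994), Exp. III Th. 5.3.7.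
-/

noncomputable section

open WittVector Field ValuativeRel Polynomial Finset
open Literature.AlgebraicGeometry.Resolution

namespace Literature.NumberTheory.PAdicHodge

open Literature.NumberTheory.GaloisRepresentations
open Literature.NumberTheory.GaloisRepresentations.IsNonarchimedeanLocalField
open GaloisContinuity
open Literature.RingTheory.FormalGroups

variable {F : Type} [Field F] [ValuativeRel F] [TopologicalSpace F] [IsNonarchimedeanLocalField F]
  [CharZero F] {p : ℕ} [Fact p.Prime] [Fact (¬ IsUnit (p : integerC F))]
  [IsAdicComplete (Ideal.span {(p : integerC F)}) (integerC F)]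

set_option maxHeartbeats 3200000 in
set_option synthInstance.maxHeartbeats 400000 in
/-- ★★★ **Structure of `(A_max)^{φ=p}`.** If `φ(x) = p·x` in `A_max = B_max⁺(F)`, then there are `N ∈ ℕ`, `λ ∈ ℤ_p`, `x₁ ∈ 𝒪_{ℂ_F}♭` with
`(x₁)₀ = 1`, a witness `z` (`ι([x₁] − 1) = p·z` in `B⁰_max`) such that
`p^{N+3}·x = p²·Λ^{log}_1([x₁] − 1, z) + ι(λ)·t`, where `Λ^{log}_1([x₁] − 1, z) = p·log[x₁] ∈ A_max` (`PadicLogSeries.logSum`, a `φ = p` eigenvector by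
`frobBmaxPlus_logSum_teichmuller_sub_one`). [cite: FontaineOuyang2022, §6.1] [cite: FontaineAsterisque223III, Exp. III Th. 5.3.7] -/
theorem exists_pow_mul_eq_logSum_add_zpToAinf_mul_tBmax (hF : Function.Surjective (fontaineTheta (integerC F) p))
    (hpv : valuation F p < 1) {x : BmaxPlus F p} (hx : frobBmaxPlus F p x = (p : BmaxPlus F p) * x) :
    ∃ (N : ℕ) (lam : ℤ_[p]) (x₁ : PreTilt (integerC F) p) (z : bmaxZero F p),
      PreTilt.coeff 0 x₁ = 1 ∧
      algebraMap (Ainf (p := p) F) (bmaxZero F p) ((teichmuller p x₁ : Ainf (p := p) F) - 1) ^ 1 = (p : bmaxZero F p) * z ∧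
      (p : BmaxPlus F p) ^ (N + 3) * x =
        (p : BmaxPlus F p) ^ 2 *
            PadicLogSeries.logSum ((algebraMap (Ainf (p := p) F) (bmaxZero F p)).comp zpToAinf)
              (fun m => if m = 0 then 0 else (-1) ^ (m + 1)) 1
              (algebraMap (Ainf (p := p) F) (bmaxZero F p) ((teichmuller p x₁ : Ainf (p := p) F) - 1)) z +
          ainfToBmaxPlus F p (zpToAinf lam) * tBmax := by
  -- (1) a Teichmüller logarithm `L₁ = log[x₁] mod Fil¹` with `θ(L₁) = p^N θ(x)`
  obtain ⟨N, L₁, ⟨x₁, hx₁, hL₁⟩, hθ₁⟩ :=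
    exists_isTeichLog_thetaBdR_eq_pow_mul hpv le_rfl (k := 1) ((thetaBmaxPlus F p x : integerC F) : CompletedAlgClosure F)
  -- (2) its `A_max`-lift `Λ = Λ^{log}_1([x₁] − 1, z)`
  have hy : ((teichmuller p x₁ : Ainf (p := p) F) - 1) ^ 1 ∈ Ideal.span {(p : Ainf (p := p) F), xi} := by
    rw [pow_one]; exact (teichmuller_sub_one_mem_span_p_xi_iff_coeff_zero x₁).2 hx₁
  obtain ⟨z, hz⟩ := exists_algebraMap_pow_eq_natCast_mul hy
  set Λ : BmaxPlus F p := PadicLogSeries.logSum ((algebraMap (Ainf (p := p) F) (bmaxZero F p)).comp zpToAinf)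
    (fun m => if m = 0 then 0 else (-1) ^ (m + 1)) 1
    (algebraMap (Ainf (p := p) F) (bmaxZero F p) ((teichmuller p x₁ : Ainf (p := p) F) - 1)) z with hΛ
  have hφΛ : frobBmaxPlus F p Λ = (p : BmaxPlus F p) * Λ := frobBmaxPlus_logSum_teichmuller_sub_one x₁ le_rfl hz
  obtain ⟨LΛ, r, hLΛ⟩ := exists_bdR_lim_modFil Λ 1
  obtain ⟨L', hpL', hL'⟩ := exists_isLogTypeModFil_of_bdR_lim_modFil_logSum (fun m => if m = 0 then 0 else (-1) ^ (m + 1)) le_rfl _ hz hLΛ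
  have hL'' : IsLogModFil 1 ((teichmuller p x₁ : Ainf (p := p) F) - 1) L' := by
    rw [← isLogTypeModFil_neg_one_pow_iff]
    exact isLogTypeModFil_congr (fun m hm => by rw [if_neg hm]) hL'
  rw [pow_one] at hpL'
  have hθΛ := thetaBdR_eq_of_bdR_lim_modFil le_rfl hLΛ
  -- (3) `θ(L') = θ(L₁)` (uniqueness of the Teichmüller logarithm modulo `Fil¹`)
  have hθ' : thetaBdR L' = thetaBdR L₁ := by
    have h := thetaBdR_eq_zero_of_mem_span_xiBdR_pow le_rfl (hL''.teichmuller_unique hL₁)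
    rwa [map_sub, sub_eq_zero] at h
  -- (4) `D = p^{N+1}x − Λ` lies in `ker θ` and is an eigenvector
  have hθD : thetaBmaxPlus F p ((p : BmaxPlus F p) ^ (N + 1) * x - Λ) = 0 := by
    have e1 : ((thetaBmaxPlus F p Λ : integerC F) : CompletedAlgClosure F) =
        (p : CompletedAlgClosure F) ^ (N + 1) * ((thetaBmaxPlus F p x : integerC F) : CompletedAlgClosure F) := by
      rw [← hθΛ, ← hpL', map_mul, map_natCast, hθ', hθ₁, pow_succ]; ring
    apply Subtype.ext
    rw [map_sub, map_mul, map_pow, map_natCast, AddSubgroupClass.coe_sub, Subring.coe_mul, SubmonoidClass.coe_pow,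
      coe_natCast_integerC, e1, sub_self, ZeroMemClass.coe_zero]
  have hφD : frobBmaxPlus F p ((p : BmaxPlus F p) ^ (N + 1) * x - Λ) = (p : BmaxPlus F p) * ((p : BmaxPlus F p) ^ (N + 1) * x - Λ) := by
    rw [map_sub, map_mul, map_pow, map_natCast, hx, hφΛ]; ring
  -- (5) Fontaine's lemma
  obtain ⟨lam, hlam⟩ := exists_sq_mul_eq_zpToAinf_mul_tBmax' hF hφD hθD
  refine ⟨N, lam, x₁, z, hx₁, hz, ?_⟩
  rw [← hlam]; ring

end Literature.NumberTheory.PAdicHodge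

end
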